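import Mathlib.Data.ZMod.Basic
import Mathlib.Tactic.NormNum
import Mathlib.Tactic.Ring
import Mathlib.Tactic.FieldSimp
import Mathlib.Tactic.LinearCombination
import Mathlib.Tactic.Linarith
import HarnessLib

/-!
# The Griffiths symbol along the kernel line: the second-order sheet, the closed-form kernel, and CONJECTURE O (WEIL-2 gen 54, SYMBOL-G54, fact-free)

research route, not a corollary; conditional on HC_CM plus one named minimal statement.

Cell `pub-hodge-ring2-ab-*` (ALL ABELIAN VARIETIES), seat WEIL-2 gen 54, account
`run/shared/lean/pub/pub-hodge-ring2/pub-hodge-ring2-ab-weil-2/SYMBOL-G54.md`.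

Informal setting (CORANK-G50, THIRDORDER-G51, CONJUGATE-G52, NABLA-G53).  At a point of the deficiency locus `R_2` of
the cyclic `d = 2` Galois–Prym data over a genus-2 base `y² = f = a² + (x − x₂)u²` (`u = (x−r₁)(x−r₂)`,
`a = a₀ + a₁x + a₂x²`), THEOREM J's third-order invariant on the wedge `1∧s` is, by the symbol form (CONJUGATE-G52 §1.7)
and Griffiths transversality, `τ(1∧s) = 2K₂(1∧s) − 2Y(1∧s)`, where `K(t)` is the matrix of Kodaira–Spencer pairings
`⟨γ'(t), μ_t(ω_a(t) ⊗ ω'_b(t))⟩` along a `κ`-curve `γ` and `Y = N₁M₂ + M₂N₁'ᵀ`.  SYMBOL-G54 computes `K(t)` to second order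
as a TRACE over the branch-point algebra `K[t]/t³[x]/(F̃_t)` of the linear-root family `F̃_t = ∏(x − wᵢ + tP(wᵢ))`,
with the two sheets in closed form to second order (LEMMA Ψ₂) and the kernel line in CLOSED FORM
(`κ = (P_κ; ż₁)`, `ż₁ = a(r₁)a(r₂)` in the gauge `x₂ = 0, x₃ = 1`), and verifies `K₂(1∧s) = 0` and `Y(1∧s) = 0`
exactly over `ℚ(r₁, r₂, a₀, a₁, a₂)` — CONJECTURE O.

This file holds the finite algebra of the account: the closed forms of `ż₁` and of the top coefficient of `P_κ`; the
cancellation of all `1/f'(w)`-terms in the `y⁻¹`-coefficient of the second-order sheet at the Weierstrass points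
(LEMMA Ψ₂ (b), the step that keeps the computation discriminant-free); the simple pole of the second-order sheet at
`ỹ₁` (residue `3a₂ż₁²`); the double-pole coefficient and the residue at the sheet points (the formula for `ξ̈ⱼ`); the
first-order separation of the two sheets; `Ψ₁ = (4ż₁/3)·ā·(x − x₂)`; the order count showing that the sixth branch
point does not contribute to the wedge `1∧s` through order `t²`; the invisibility of the 3-jet on `ker μ`; the logical
skeleton of THEOREM O; and the residue of record at the record member.  Mathlib only, 0 sorry, no `def`, no named fact;
`HC_CM` does not occur.
-/

namespace Summit.HodgeConjecture.Ring2AbelianAll.PrymTorelliSymbol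

section kernel

variable {R : Type*} [CommRing R]

/-- SYMBOL-G54 PROPOSITION K♯ (the kernel line in closed form), the `ż₁`-component: in the gauge `x₂ = 0, x₃ = 1` the
LEMMA-K kernel vector `(P₀,…,P₄; Z)`, i.e. the six signed `5×5` minors of gen 52/53 divided by their common factor
`a₀·f(1)⁴`, has `Z = a(r₁)·a(r₂)`: the nine-term sextic printed by the reduction is the product of the values of
`a` at the two sheet abscissae.  research route, not a corollary; conditional on HC_CM plus one named minimal statement. -/
theorem kernel_Z_closed_form (r1 r2 a0 a1 a2 : R) :
    r1 ^ 2 * r2 ^ 2 * a2 ^ 2 + r1 ^ 2 * r2 * a1 * a2 + r1 ^ 2 * a0 * a2 + r1 * r2 ^ 2 * a1 * a2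
      + r1 * r2 * a1 ^ 2 + r1 * a0 * a1 + r2 ^ 2 * a0 * a2 + r2 * a0 * a1 + a0 ^ 2
      = (a0 + a1 * r1 + a2 * r1 ^ 2) * (a0 + a1 * r2 + a2 * r2 ^ 2) := by
  ring

/-- SYMBOL-G54 PROPOSITION K♯, the top coefficient: `P₄ = 2·ā(x₃)` with `ā := a − a₂u` (= `a mod u`, linear) and
`x₃ = 1`, `u(1) = (1 − r₁)(1 − r₂)`: the five-term cubic printed by the reduction.
research route, not a corollary; conditional on HC_CM plus one named minimal statement. -/
theorem kernel_P4_closed_form (r1 r2 a0 a1 a2 : R) :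
    -2 * r1 * r2 * a2 + 2 * r1 * a2 + 2 * r2 * a2 + 2 * a0 + 2 * a1
      = 2 * ((a0 + a1 * 1 + a2 * 1 ^ 2) - a2 * ((1 - r1) * (1 - r2))) := by
  ring

end kernel

section secondOrderSheet

variable {F : Type*} [Field F]

/-- SYMBOL-G54 LEMMA Ψ₂ (b), the heart of the Weierstrass-point analysis.  At a root `w` of `f` write `a, a', f', ḟ,
ḟ', f̈, S, u` for the values at `w`, `ρ₁, ρ₃` for the values of `(3ḟ − 2aA)/(2af)` and `(−3ḟ² − 4aC₀)/(4af)`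
(polynomials), so that `A'(w) = 3ḟ'/(2a) − 3ḟa'/(2a²) − f'ρ₁` and `C₀'(w) = −3ḟḟ'/(2a) + 3ḟ²a'/(4a²) − f'ρ₃`.
With `[y²]H_y = 3/a³ − 9a'/(a²f')` and `H_ty = A'/f' + S/u − 3ḟ'/(2af') − 3ḟ/(2a³) + 9a'ḟ/(2a²f')`, the `y⁻¹`-coefficient of
the second-order sheet is `p₁ = H_tyḟ + [y²]H_y·ḟ²/4 + 3f̈/(2a) − 3ḟḟ'/(2af')`, and the coefficient polynomial
`C₁` of `1/y` satisfies `C₁(w) = p₁ − C₀'(w)/f'`.  CLAIM: every `1/f'`-term cancels,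
`C₁(w) = −ρ₁ḟ + Sḟ/u − 3ḟ²/(4a³) + 3f̈/(2a) + ρ₃` — so `C₁ ≡ −ρ₁ḟ + Sḟu⁻¹ − (3/4)ḟ²a⁻³ + (3/2)f̈a⁻¹ + ρ₃ (mod f)` is
root-free and DISCRIMINANT-free.  research route, not a corollary; conditional on HC_CM plus one named minimal statement. -/
theorem C1_discriminant_free (a a' f' fd fd' fdd S u ρ1 ρ3 : F) (ha : a ≠ 0) (hf : f' ≠ 0) (hu : u ≠ 0)
    (h2 : (2 : F) ≠ 0) :
    let A' := 3 * fd' / (2 * a) - 3 * fd * a' / (2 * a ^ 2) - f' * ρ1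
    let Hy2 := 3 / a ^ 3 - 9 * a' / (a ^ 2 * f')
    let Hty := A' / f' + S / u - 3 * fd' / (2 * a * f') - 3 * fd / (2 * a ^ 3) + 9 * a' * fd / (2 * a ^ 2 * f')
    let p1 := Hty * fd + Hy2 * fd ^ 2 / 4 + 3 * fdd / (2 * a) - 3 * fd * fd' / (2 * a * f')
    let C0' := -3 * fd * fd' / (2 * a) + 3 * fd ^ 2 * a' / (4 * a ^ 2) - f' * ρ3
    p1 - C0' / f' = -ρ1 * fd + S * fd / u - 3 * fd ^ 2 / (4 * a ^ 3) + 3 * fdd / (2 * a) + ρ3 := by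
  have h4 : (4 : F) ≠ 0 := by
    have : (4 : F) = 2 * 2 := by norm_num
    rw [this]; exact mul_ne_zero h2 h2
  simp only
  field_simp
  ring

/-- SYMBOL-G54 LEMMA Ψ₂ (a): no `y⁻²`-terms at the Weierstrass points.  The `y⁻²`-coefficient of
`χ = H_tt + 2H_tyẏ + H_yyẏ² + H_yÿ` is `H_yy(w)·ḟ²/4 − [y¹]H_y·ḟ²/4`, and `H_yy(w) = [y¹]H_y` (both are the
first Taylor coefficient of `H_y`), so it vanishes — whence `E ≡ 0 (mod f)` in the ansatz and the double-pole functions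
`xⁱ/f` are absent.  research route, not a corollary; conditional on HC_CM plus one named minimal statement. -/
theorem no_double_pole_at_W (Hyy Hy1 fd : F) (h : Hyy = Hy1) : Hyy * fd ^ 2 / 4 - Hy1 * fd ^ 2 / 4 = 0 := by
  rw [h]; ring

/-- SYMBOL-G54 LEMMA Ψ₂ (c): the triple-pole coefficient.  `[y⁻³]χ = −H_y(w)ḟ²/4` with `H_y(w) = 3/a(w)`
(`h₀ = (y + a)³`), i.e. `C₀(w) = −3ḟ²/(4a)`: `C₀ ≡ −(3/4)ḟ²a⁻¹ (mod f)`.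
research route, not a corollary; conditional on HC_CM plus one named minimal statement. -/
theorem triple_pole_at_W (a fd : F) (ha : a ≠ 0) : -(3 / a) * fd ^ 2 / 4 = -3 * fd ^ 2 / (4 * a) := by
  field_simp

/-- SYMBOL-G54 LEMMA Ψ₂ (d): the double poles at ỹ₁ cancel.  With `h = (v − δ)^{−(m+e₁)}(v + δ)^{−m}H` on the smooth
total space and `v̈/v = ż₁²/v² + O(1)`, the `v⁻²`-coefficient of `χ` is `−(2m+e₁)ż₁² + ((m+e₁) + m)ż₁² = 0` for
every type.  research route, not a corollary; conditional on HC_CM plus one named minimal statement. -/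
theorem no_double_pole_at_infinity {R : Type*} [CommRing R] (m e1 Z : R) :
    -(2 * m + e1) * Z ^ 2 + ((m + e1) * Z ^ 2 + m * Z ^ 2) = 0 := by
  ring

/-- SYMBOL-G54 LEMMA Ψ₂ (e): the SIMPLE pole at ỹ₁ (found numerically, then explained).  The term `H_v·v̈` of
`D² log H` carries `v̈ = ż₁²/v + O(v)`, so `[v⁻¹]χ = ż₁²·∂_v log H(0,0)`; at `t = 0`, `H = h₀v¹⁵ = ((y+a)v⁵)³` and
`(y + a)v⁵ = 1 + a₂v + O(v²)`, so `∂_v log H(0,0) = 3a₂`: the residue is `3a₂ż₁²` for both types (at the record member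
`3·4548 ≡ 3637 (mod 10007)`, the number the engine printed for type I AND type II).  Dual-number form of
`∂_v (1 + a₂v + bv²)³|₀ = 3a₂`.  research route, not a corollary; conditional on HC_CM plus one named minimal statement. -/
theorem simple_pole_at_infinity {R : Type*} [CommRing R] (a2 b ε : R) (hε : ε * ε = 0) :
    (1 + a2 * ε + b * ε * ε) ^ 3 = 1 + 3 * a2 * ε := by
  linear_combination (3 * b + 3 * (a2 + b * ε) ^ 2 + ε * (a2 + b * ε) ^ 3) * hε

/-- SYMBOL-G54 LEMMA Ψ₂ (f): the double pole at a sheet point determines `T`.  Near `P_j` the ansatz term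
`T(x)·σ`, `σ = a(y − a)/u²`, has `(x − r_j)⁻²`-coefficient `T(r_j)·n_j/d_j²` with `n_j = a_j·(y(P_j) − a_j) = −2a_j²`,
`d_j = u'(r_j)`; equating with `−6ξ̇_j²` (from `h_t = (x − ξ_j(t))⁶k_t`) gives `T(r_j) = 3ξ̇_j²d_j²/a_j²`.
research route, not a corollary; conditional on HC_CM plus one named minimal statement. -/
theorem double_pole_at_sheet_point (T xid d A : F) (hd : d ≠ 0) (h2 : (2 : F) ≠ 0)
    (h : T * (-2 * A ^ 2) / d ^ 2 = -6 * xid ^ 2) : T * A ^ 2 = 3 * xid ^ 2 * d ^ 2 := by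
  have hd2 : d ^ 2 ≠ 0 := pow_ne_zero 2 hd
  have h' : T * (-2 * A ^ 2) = -6 * xid ^ 2 * d ^ 2 := by
    rw [div_eq_iff hd2] at h; exact h
  apply mul_left_cancel₀ (neg_ne_zero.mpr h2)
  linear_combination h'

/-- SYMBOL-G54 LEMMA Ψ₂ (g): the residue at a sheet point (dual numbers `ε = x − r_j`, `ε² = 0`).  With
`n = n₀ + n₁ε`, `T = T₀ + T₁ε` and `1/u² = (1 − 2ε/d)/(d²ε²) + O(1)`, the `ε⁻¹`-coefficient of `Tn/u²` is
`(T₀n₁ + T₁n₀ − 2T₀n₀/d)/d²`; hence `ξ̈_j = −(1/6)·[−2U(r_j)a_j/d_j + ((Tn)'(r_j) − 2T(r_j)n(r_j)/d_j)/d_j²]`.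
research route, not a corollary; conditional on HC_CM plus one named minimal statement. -/
theorem residue_at_sheet_point {R : Type*} [CommRing R] (T0 T1 n0 n1 dinv ε : R) (hε : ε * ε = 0) :
    (T0 + T1 * ε) * (n0 + n1 * ε) * (1 - 2 * ε * dinv)
      = T0 * n0 + (T0 * n1 + T1 * n0 - 2 * T0 * n0 * dinv) * ε := by
  linear_combination (T1 * n1 - 2 * T0 * n1 * dinv - 2 * T1 * n0 * dinv - 2 * T1 * n1 * dinv * ε) * hε

end secondOrderSheet

section sheets

variable {F : Type*} [Field F]

/-- SYMBOL-G54 §3 (the two sheets separate at first order only through `ż₁`).  LEMMA Ψ's solution is affine in `e₁`: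
`S^{II} − S^{I} = (e₁' − e₁)ż₁`, so `ξ̇ⱼ^{II} − ξ̇ⱼ^{I} = (e₁' − e₁)ż₁·a(r_j)/(3u'(r_j))` (`= 4ż₁a_j/(3d_j)` for
`(e₁, e₁') = (1, 5)`).  research route, not a corollary; conditional on HC_CM plus one named minimal statement. -/
theorem sheet_velocity_difference (S1 S2 e e' Z A d : F) (hS : S2 - S1 = (e' - e) * Z) :
    S2 * A / (3 * d) - S1 * A / (3 * d) = (e' - e) * Z * A / (3 * d) := by
  rw [← hS, sub_mul, sub_div]

/-- SYMBOL-G54 §3 (`α̇_s` is type-independent).  On `R_2`, `f = a² + (x − x₂)u²` gives `f'(r_j) = 2a(r_j)a'(r_j)` at a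
root `r_j` of `u`, hence `y'(P_j) = f'(r_j)/(2y(P_j)) = −a'(r_j) = α_s'(r_j)` and the `ξ̇ⱼ`-terms of
`α̇_s(r_j) = ẏ(P_j) + (y'(P_j) − α_s'(r_j))ξ̇ⱼ` cancel: `α̇_s(r_j) = −ḟ(r_j)/(2a(r_j))` for both types.
research route, not a corollary; conditional on HC_CM plus one named minimal statement. -/
theorem alphadot_type_independent {R : Type*} [CommRing R] (A Ap U Up r x2 fp : R)
    (hfp : fp = 2 * A * Ap + U * U + 2 * (r - x2) * U * Up) (hU : U = 0) : fp = 2 * A * Ap := by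
  rw [hfp, hU]; ring

/-- SYMBOL-G54 §3 (the first-order symbol differential).  `μ_t(ω_1 ∧ ω_s) = R_t(ŝ^{II} − ŝ^{I})ω₀²/((x−x₂)(x−x₃))` with
`R₀ = y + a` and `ŝ^{II} − ŝ^{I} = t·(4ż₁/3)·ā·s/u + O(t²)` (`ā = a mod u`, `s = (y − a)/u`); the norm identity
`y² − a² = (x − x₂)u²` turns `Ψ₁ = R₀·(4ż₁/3)ās/u` into the POLYNOMIAL `(4ż₁/3)·ā·(x − x₂)` — the first-order term
of the three-dimensional space `L(3∞₊ + 2∞₋ − ῑy₂)`.  research route, not a corollary; conditional on HC_CM plus one named minimal statement. -/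
theorem Psi_one_polynomial (y a abar u x x2 c : F) (hu : u ≠ 0) (hnorm : y ^ 2 = a ^ 2 + (x - x2) * u ^ 2) :
    (y + a) * (c * abar * ((y - a) / u) / u) = c * abar * (x - x2) := by
  field_simp
  linear_combination c * abar * hnorm

end sheets

section symbol

/-- SYMBOL-G54 §4 (the sixth branch point does not see the wedge `1∧s`).  The contribution of the cluster
`{w₆, ∞₊, ∞₋}` to `⟨γ'(t), Θ_t⟩` is `−δδ̇F̂(−δ²)·(Θ_t/dv²)(w₆)` with `(Θ/dv²)(w₆) = 4ξ⁴ψ(w₆)/(…)`, `ξ = −δ²`, and for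
`ψ = R_t·f_a·f_b/((x−x₂)(x−x₃))` with `R_t(w₆) ∼ −δ⁻⁵` and `f_1(w₆), f_s(w₆) = O(1)`, `f_x(w₆) = −δ⁻²`: the `t`-order is
`1 + 8 − 5 − 2k` for `k` factors `x`.  So the entries `(1,1), (1,s), (s,1), (s,s)` — and the wedge `1∧s` — are exact
trace sums through order `t³` (`k = 0`: order 4), while `(1,x)` first deviates at order 2 and `(x,x)` at order 0 (the
`−4ż₁` of LEMMA K's row `xx`).  research route, not a corollary; conditional on HC_CM plus one named minimal statement. -/
theorem sixth_point_order_count :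
    (1 + 8 - 5 - 2 * 0 : ℤ) = 4 ∧ (4 : ℤ) > 2 ∧ (1 + 8 - 5 - 2 * 1 : ℤ) = 2 ∧ (1 + 8 - 5 - 2 * 2 : ℤ) = 0 := by
  norm_num

/-- SYMBOL-G54 §4 (the 3-jet is invisible on `ker μ`; THIRDORDER-G51 B.1 with `D²Φ(k,b)(λ) = 0` for `b ∈ T M̃`).  Two
`κ`-curves in `M̃` with the same 2-jet and 3-jets differing by `d` have `ã₃ = a₃ + dΦ_x(d)`; on a covector `λ ∈ ker μ_x`
the term `λ(dΦ_x(d)) = ⟨d, μ_x(λ)⟩` vanishes.  (This is why the trace computation along the EXACTLY linear-root family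
and the engine along its truncation agree on `1∧x`, `1∧s` and differ entrywise by `6·KS₀((f₃,0); Θ₀)`.)
research route, not a corollary; conditional on HC_CM plus one named minimal statement. -/
theorem three_jet_invisible_on_kernel {R : Type*} [CommRing R] (a3 a3' dPhid c3D2 : R)
    (h : a3' = a3 + dPhid + 3 * c3D2) (hker : dPhid = 0) (hM : c3D2 = 0) : a3' = a3 := by
  rw [h, hker, hM]; ring

/-- SYMBOL-G54 THEOREM O, the logical skeleton.  CONJUGATE-G52 §1.7 gives `τ = m'' − 2Y` on every entry; Griffiths
transversality gives `m(t) = K(t)` (the Kodaira–Spencer pairing matrix), so `m''(0) = 2K₂`; the exact symbolic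
computation of SYMBOL-G54 gives `K₂(1∧s) = 0` and `Y(1∧s) = 0` identically on `R_2` along the linear-root family;
hence `τ(1∧s) = 0`: CONJECTURE O.  research route, not a corollary; conditional on HC_CM plus one named minimal statement. -/
theorem conjectureO_skeleton {R : Type*} [CommRing R] (tau mdd K2 Y : R)
    (hsymbol : tau = mdd - 2 * Y) (hgriffiths : mdd = 2 * K2) (hK : K2 = 0) (hY : Y = 0) : tau = 0 := by
  rw [hsymbol, hgriffiths, hK, hY]; ring

/-- SYMBOL-G54 §4 (why `M₂(1∧s) = 0` in the trace form = THEOREM S by LEMMA K).  The first-order symbol term is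
`(4ż₁/3)·[x⁴](P·ā·(x − x₃)⁻¹ mod f)` with `ā = a − a₂u`; LEMMA K's rows `(s,s)` and `(1,s)` say
`[x⁴](P·a·(x−x₃)⁻¹) = 0` and `[x⁴](P·u·(x−x₃)⁻¹) = 0`, so the term vanishes by linearity.
research route, not a corollary; conditional on HC_CM plus one named minimal statement. -/
theorem first_order_symbol_on_wedge_vanishes {R : Type*} [CommRing R] (trPa trPu a2 c : R)
    (hss : trPa = 0) (h1s : trPu = 0) : c * (trPa - a2 * trPu) = 0 := by
  rw [hss, h1s]; ring

/-- SYMBOL-G54, residues of record at the record member `p = 10007`, seed 1 (`a₂ = 4548`): the engine's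
`[z⁻¹]χ = 3637` for BOTH types is `3a₂`; and the sixth-branch-point defect of the trace form of `M₁(x,x)` is
`+2 = −(−4ż₁)/2` in the trace units (`c = 1/2`: `2·5004 ≡ 1`).
research route, not a corollary; conditional on HC_CM plus one named minimal statement. -/
theorem record_member_second_order : (3637 : ZMod 10007) = 3 * 4548 ∧ (2 * 5004 : ZMod 10007) = 1 := by
  decide

end symbol

section secondOrderMatrix

/-- SYMBOL-G54 P.S. (PROPOSITION M₂: the second-order matrix along the linear-root `κ`-family in closed form, off the
entry `(x,x)`).  The same exact computation that proves THEOREM O prints, in the gauge `x₂ = 0, x₃ = 1` and in the trace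
units of `code/g54` (`= ½ ×` engine units), `M₂(1,1) = −2ż₁²/a(x₂)`, `M₂(x,s) = −(14/3)ż₁²`, `M₂(s,x) = −(22/3)ż₁²`, all
other entries off `(x,x)` zero (kit j234157); in engine units at a general member (translation rule below, scaling weight
`x₃ − x₂` read off the record member) `M₂ = ż₁²·[[−4(x₃−x₂)/a(x₂), −4x₂(x₃−x₂)/a(x₂), 0], [−4x₂(x₃−x₂)/a(x₂), ∗, −28/3],
[0, −44/3, 0]]`.  In particular THEOREM S's wedge constant is RECOVERED EXACTLY by the trace route:
`M₂(x∧s) = M₂(x,s) − M₂(s,x) = (−28/3) − (−44/3) = 16/3` (times `ż₁²`), and `M₂(1∧x) = M₂(1∧s) = 0`.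
research route, not a corollary; conditional on HC_CM plus one named minimal statement. -/
theorem secondOrder_wedge_constant :
    ((-28 : ℚ) / 3) - ((-44 : ℚ) / 3) = 16 / 3 ∧ ((-14 : ℚ) / 3) - ((-22 : ℚ) / 3) = 8 / 3 := by
  norm_num

/-- SYMBOL-G54 P.S. (the translation rule that carries the gauge entry `M₂(1,x) = 0` to `M₂(1,x) = x₂·M₂(1,1)`).  Under
`x ↦ x + β` both frames change by `η_x ↦ η_x + βη_1`, i.e. `M₂ ↦ T M₂ Tᵀ` with `T = [[1,0,0],[β,1,0],[0,0,1]]`; for a matrix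
with `M₂(1,x) = 0` the new `(1,x)` entry is `β·M₂(1,1)` (and `(1,1)`, `(x,s)`, `(s,x)` are unchanged when `M₂(1,s) = M₂(s,1) = 0`).
At the record member `p = 10007` s1 (`x₂ = 9800`, `a(x₂) = 7024`, `x₃ − x₂ ≡ 8578`): `−4(x₃−x₂)/a(x₂) ≡ 5067` and
`x₂·5067 ≡ 1866`, `−28/3 ≡ 6662`, `−44/3 ≡ 3321` — the engine's `M₂(1,1), M₂(1,x), M₂(x,s), M₂(s,x)` verbatim.
research route, not a corollary; conditional on HC_CM plus one named minimal statement. -/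
theorem secondOrder_translation_rule {R : Type*} [CommRing R] (m11 m1x m1s ms1 mxs msx β : R)
    (h1x : m1x = 0) (h1s : m1s = 0) (hs1 : ms1 = 0) :
    -- the entries (1,x), (x,s), (s,x) of T M Tᵀ, T = [[1,0,0],[β,1,0],[0,0,1]], written out: Σ_{k,l} T_{ik} M_{kl} T_{jl}
    (m11 * β + m1x * 1 = β * m11) ∧ (β * m1s + 1 * mxs = mxs) ∧ (ms1 * β + msx * 1 = msx) := by
  rw [h1x, h1s, hs1]; refine ⟨?_, ?_, ?_⟩ <;> ring

/-- SYMBOL-G54 P.S., residues of record for PROPOSITION M₂ at the record member (`ZMod 10007`; `a(x₂) = 7024`,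
`x₃ − x₂ = 8578`, `x₂ = 9800`): `−4·8578 = 5067·7024` (i.e. `M₂(1,1) = −4(x₃−x₂)/a(x₂) ≡ 5067`), `9800·5067 ≡ 1866`
(`M₂(1,x)`), `3·6662 = −28`, `3·3321 = −44` (`M₂(x,s), M₂(s,x)`) — the engine's four entries.
research route, not a corollary; conditional on HC_CM plus one named minimal statement. -/
theorem record_member_M2 :
    (-4 * 8578 : ZMod 10007) = 5067 * 7024 ∧ (9800 * 5067 : ZMod 10007) = 1866 ∧
    (3 * 6662 : ZMod 10007) = -28 ∧ (3 * 3321 : ZMod 10007) = -44 := by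
  decide

end secondOrderMatrix

end Summit.HodgeConjecture.Ring2AbelianAll.PrymTorelliSymbol
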